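import Summits.BirchSwinnertonDyer.BirchSwinnertonDyer.Theorems.GenusKolyvaginAtTwoGenusPrimitiveSupplyAtTwoTwistLocalFrame
import Summits.BirchSwinnertonDyer.BirchSwinnertonDyer.Theorems.GenusKolyvaginAtTwoGenusPrimitiveSupplyAtTwoArchimedeanTransverse
import Summits.BirchSwinnertonDyer.BirchSwinnertonDyer.Theorems.GenusKolyvaginAtTwoGenusPrimitiveSupplyAtTwoTwistUnramifiedMultRow
import HarnessLib

/-!
# Route `GenusKolyvaginAtTwo`, crux #2 `GenusPrimitiveSupplyAtTwo` (stmt-BirchSwinnertonDyer-22136):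
# THE MASTER DATUM — ONE identification `E^{(d)}[2] ≅ E[2]` carrying EVERY local row of Mazur–Rubin §2 at once
# (Lemma 2.10 (i), (iii), (v) — the dyadic places included —, Lemma 2.11, Lemma 2.9 at the real places) AND the frame datum

Width seat `bsd-line-gk2-p5` g12 (cell `bsd-f1-sign2`, SUPPLY lineage), file 43 of the series: sequel of g11's `…TwistUnramifiedMultRow`
(§95, the unramified semistable row for the signed untwisting datum) and of gk2-p4 g12's `…TwistLocalFrame` (§76: split agreement +
Lemma 2.11 + frame for ONE identification) / `…ArchimedeanFrame` (§70: split agreement + real transversality + frame). THEOREMS ONLY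
(no definition, no named fact, no `sorry`, no local instance); helper `--supports stmt-BirchSwinnertonDyer-22136`; no item is closed;
BSD is not proved by any of this.

WHAT. Every transfer law of the lineage (Cor. 3.4 (i)/(ii) with `T = ∅`, `T = {v₀}` finite, `T = {w₀}` real, finite `T`) starts from ONE
identification `φ : Wd[2] ≅ W[2]` and a list of LOCAL ROWS for that `φ`; so far each package (`exists_intertwining_hsplit_and_transverse_frame`,
`…_and_transverse_inl_frame`, `…_and_unramified`) displayed a different subset, and the five-row finite menu of g11 (§96) could not be
combined with the frame datum (Kramer's congruence) or with the transversality rows. Here all rows are put on the SAME `φ`: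

* §97 **`exists_intertwining_master_frame`** — for `W/K`, `d ≠ 0`, `Wd = C • W^{(d)}`: ONE pair of inverse intertwinings
  `φ : Wd[2] ⇄ W[2] : φ'` with (i) the split-place agreement (Lemma 2.10 (i)), (ii) the UNRAMIFIED SEMISTABLE row at every finite place
  of any residue characteristic (`ι√d ∈ K_v^{nr}`, `W` good or multiplicative with `ord_v Δ_min` odd ⟹ `φ_* 𝓛_v(Wd) = 𝓛_v(W)`;
  Lemma 2.10 (iii), (v)), (iii) Lemma 2.11 (transversality at ramified good odd places), (iv) Lemma 2.9 at `v ∣ ∞` (transversality at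
  every real place `w` with `w(Δ_W) > 0`, `d ∉ K_w²`; Kramer Prop. 6), (v) the frame datum (`φ T'_j = T_{πj}`,
  `x'_i − x'_j = A·(x_{πi} − x_{πj})`) — proof = §76 verbatim on `exists_addEquiv_geomTorsion_two_localSquare_signed_frame` plus the two
  rows (ii), (iv) read off the same signed local untwistings. The real-`T`-place laws with the five-row menu and the cell's T-A⁵ / T-A⁵′
  rows follow in the sequel files `…ArchimedeanUnramifiedFrame` / `…ArchimedeanUnramifiedRowsHold`.

References: [MazurRubin2010] Remark 2.4, Lemmas 2.9, 2.10 (i)–(v), 2.11 (arXiv:0904.3709 pp. 7–8); [Kramer1981] §2 Props. 1, 2 (a), 3, 6;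
[KramerTunnell1982] §6 Lemma 6.1; [KlagsbrunMazurRubin2013] Lemma 5.2; [SilvermanAEC2009] X.5 Cor. 5.4.
-/

set_option linter.dupNamespace false -- tree convention: `Summit.BirchSwinnertonDyer.BirchSwinnertonDyer.Theorems` (summit = sub-problem)
set_option autoImplicit false

noncomputable section

open scoped Classical ContRepresentation

/-! ## §97 The master datum: one identification with every local row and the frame -/

namespace Summit.BirchSwinnertonDyer.BirchSwinnertonDyer.Theorems.GenusKolyTwistLocal

open WeierstrassCurve Field NumberField IsDedekindDomain Function
open Literature.NumberTheory.EllipticCurves Literature.NumberTheory.GaloisRepresentations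
open Literature.NumberTheory.EllipticCurves.DokchitserDokchitser2012 (T xT)
open Literature.NumberTheory.GaloisRepresentations.IsNonarchimedeanLocalField
open Literature.NumberTheory.GaloisRepresentations.DiscreteGaloisModule (SelmerStructure)
open Literature.NumberTheory.GaloisCohomology
open Summit.BirchSwinnertonDyer.Rank1Residual.X11b
open Summit.BirchSwinnertonDyer.Rank1Residual.X11b.CongruentTransfer
open Summit.BirchSwinnertonDyer.BirchSwinnertonDyer.Theorems.GenusKolyArch
  (map_kummerLocalConditionAt_adicCompletion_eq_of_semistable_of_mem_maxUnramified
    map_kummerLocalConditionAt_inf_eq_bot_of_neg_of_isReal)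

variable {K : Type} [Field K] [NumberField K] (W Wd : WeierstrassCurve K) [W.IsElliptic] [Wd.IsElliptic]

/-- **THE MASTER DATUM: ONE identification `E^{(d)}[2] ≅ E[2]` with EVERY local row of Mazur–Rubin §2 and the frame.** For `W/K`
elliptic over a number field, `d ≠ 0`, `Wd = C • W^{(d)}` elliptic: mutually inverse `Γ_K`-intertwinings `φ : Wd[2] ⇄ W[2] : φ'` (the
untwisting of `exists_addEquiv_geomTorsion_two_localSquare_signed_frame`) such that
(i) at every `K`-field where `d` is a square, `φ_* 𝓛(Wd) = 𝓛(W)` (Lemma 2.10 (i));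
(ii) at every finite place `v` UNRAMIFIED in `K(√d)` (`ι√d ∈ K_v^{nr}`, any residue characteristic, `v ∣ 2` included) where `W` is
good, or multiplicative with `ord_v Δ_min` odd, `φ_* 𝓛_v(Wd) = 𝓛_v(W)` (Lemma 2.10 (v), (iii): Mazur's norm theorem / Kramer Props. 1, 2 (a));
(iii) at every good place `v ∤ 2` RAMIFIED in `K(√d)`, `φ_* 𝓛_v(Wd) ⊓ 𝓛_v(W) = 0` (Lemma 2.11);
(iv) at every REAL place `w` with `w(Δ_W) > 0` where `d` is not a square, `φ_* 𝓛_w(Wd) ⊓ 𝓛_w(W) = 0` (Lemma 2.9 at `v ∣ ∞`,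
Kramer Prop. 6);
(v) the FRAME DATUM `φ T'_j = T_{πj}`, `x'_i − x'_j = A·(x_{πi} − x_{πj})` (input of Kramer's congruence for framed identifications).
Proof: gk2-p4's §76 verbatim, plus rows (ii) (§95) and (iv) (file 23) read off the same signed local untwistings.
[cite: MazurRubin2010, Remark 2.4, Lemmas 2.9, 2.10 (i), (iii), (v), 2.11] [cite: Kramer1981, §2 Props. 1, 2 (a), 6]
[cite: KramerTunnell1982, §6 Lemma 6.1] [cite: KlagsbrunMazurRubin2013, Lemma 5.2] [cite: SilvermanAEC2009, X.5 Cor. 5.4] -/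
theorem exists_intertwining_master_frame {d : K} (hd : d ≠ 0) {C : VariableChange K}
    (hWd : C • W.quadraticTwist d = Wd) :
    ∃ (φ : (Wd.torsionGaloisModule ((2 : ℕ) : ℤ)).toContRepresentation →ⁱL
        (W.torsionGaloisModule ((2 : ℕ) : ℤ)).toContRepresentation)
      (φ' : (W.torsionGaloisModule ((2 : ℕ) : ℤ)).toContRepresentation →ⁱL
        (Wd.torsionGaloisModule ((2 : ℕ) : ℤ)).toContRepresentation),
      (∀ a, φ' (φ a) = a) ∧ (∀ b, φ (φ' b) = b) ∧
      (∀ (E : Type) [Field E] [Algebra K E], (∃ s : E, s ^ 2 = algebraMap K E d) →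
        (Wd.kummerLocalConditionAt ((2 : ℕ) : ℤ) E).map (galoisCohomology.map (φ.restrictField E) 1) =
          W.kummerLocalConditionAt ((2 : ℕ) : ℤ) E) ∧
      (∀ (v : HeightOneSpectrum (𝓞 K)),
        (W.HasGoodReductionAt v ∨ (W.HasMultiplicativeReductionAt v ∧ Odd (W.ordMinimalDiscriminant v))) →
        closureEmb (K := K) (v.adicCompletion K) (geomSqrt d) ∈ maxUnramified (v.adicCompletion K) →
        (Wd.kummerLocalConditionAt ((2 : ℕ) : ℤ) (v.adicCompletion K)).map
            (galoisCohomology.map (φ.restrictField (v.adicCompletion K)) 1) =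
          W.kummerLocalConditionAt ((2 : ℕ) : ℤ) (v.adicCompletion K)) ∧
      (∀ (v : HeightOneSpectrum (𝓞 K)), W.HasGoodReductionAt v → ((2 : ℕ) : 𝓞 K) ∉ v.asIdeal →
        closureEmb (K := K) (v.adicCompletion K) (geomSqrt d) ∉ maxUnramified (v.adicCompletion K) →
        (Wd.kummerLocalConditionAt ((2 : ℕ) : ℤ) (v.adicCompletion K)).map
            (galoisCohomology.map (φ.restrictField (v.adicCompletion K)) 1) ⊓
          W.kummerLocalConditionAt ((2 : ℕ) : ℤ) (v.adicCompletion K) = ⊥) ∧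
      (∀ (w : InfinitePlace K) (hw : w.IsReal), 0 < InfinitePlace.embedding_of_isReal hw W.Δ →
        (∀ s : w.Completion, s ^ 2 ≠ algebraMap K w.Completion d) →
        (Wd.kummerLocalConditionAt ((2 : ℕ) : ℤ) w.Completion).map
            (galoisCohomology.map (φ.restrictField w.Completion) 1) ⊓
          W.kummerLocalConditionAt ((2 : ℕ) : ℤ) w.Completion = ⊥) ∧
      ∃ (π : Fin 3 → Fin 3) (A : K),
        (∀ j, (show (Wd.torsionGaloisModule 2).toContRepresentation →ⁱL (W.torsionGaloisModule 2).toContRepresentation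
          from φ) (T Wd (two_ne_zero (α := K)) j) = T W (two_ne_zero (α := K)) (π j)) ∧
        (∀ i j, xT Wd (two_ne_zero (α := K)) i - xT Wd (two_ne_zero (α := K)) j
          = algebraMap K (AlgebraicClosure K) A
            * (xT W (two_ne_zero (α := K)) (π i) - xT W (two_ne_zero (α := K)) (π j))) := by
  haveI : NeZero (2 : K) := ⟨two_ne_zero⟩
  obtain ⟨ψ, hψ, ⟨π, A, hπ, hA⟩, hloc⟩ := exists_addEquiv_geomTorsion_two_localSquare_signed_frame W hd hWd
  have hψ' : ∀ (σ : absoluteGaloisGroup K) (Q : geomTorsion W (2 : ℤ)),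
      ψ.symm (σ • Q) = σ • ψ.symm Q := fun σ Q ↦
    ψ.injective (by rw [hψ, ψ.apply_symm_apply, ψ.apply_symm_apply])
  let φ : (Wd.torsionGaloisModule ((2 : ℕ) : ℤ)).toContRepresentation →ⁱL
      (W.torsionGaloisModule ((2 : ℕ) : ℤ)).toContRepresentation :=
    { toContinuousLinearMap := ⟨ψ.toAddMonoidHom.toIntLinearMap, continuous_of_discreteTopology⟩
      isIntertwining' := fun σ ↦ by
        ext P
        exact congrArg Subtype.val (hψ σ P) }
  let φ' : (W.torsionGaloisModule ((2 : ℕ) : ℤ)).toContRepresentation →ⁱL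
      (Wd.torsionGaloisModule ((2 : ℕ) : ℤ)).toContRepresentation :=
    { toContinuousLinearMap := ⟨ψ.symm.toAddMonoidHom.toIntLinearMap, continuous_of_discreteTopology⟩
      isIntertwining' := fun σ ↦ by
        ext Q
        exact congrArg Subtype.val (hψ' σ Q) }
  have hφ : ∀ a, φ a = ψ a := fun _ ↦ rfl
  have hφ' : ∀ b, φ' b = ψ.symm b := fun _ ↦ rfl
  have hφ'φ : ∀ a, φ' (φ a) = a := fun a ↦ ψ.symm_apply_apply a
  have hφφ' : ∀ b, φ (φ' b) = b := fun b ↦ ψ.apply_symm_apply b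
  -- one inclusion of Lemma 2.10 (i), for an arbitrary Γ_E-equivariant intertwined local datum (§76 verbatim)
  have key : ∀ (E : Type) [Field E] [Algebra K E] {X Y : WeierstrassCurve K}
      (χ : (X.torsionGaloisModule ((2 : ℕ) : ℤ)).toContRepresentation →ⁱL
        (Y.torsionGaloisModule ((2 : ℕ) : ℤ)).toContRepresentation) (η : localPoints X E ≃+ localPoints Y E),
      (∀ (σ : absoluteGaloisGroup E) (Q : localPoints X E), η (σ • Q) = σ • η Q) →
      (∀ t : geomTorsion X ((2 : ℕ) : ℤ),
        pointsMap Y E (χ t : geomPoints Y) = η (pointsMap X E (t : geomPoints X))) →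
      ∀ x ∈ X.kummerLocalConditionAt ((2 : ℕ) : ℤ) E,
        galoisCohomology.map (χ.restrictField E) 1 x ∈ Y.kummerLocalConditionAt ((2 : ℕ) : ℤ) E := by
    intro E _ _ X Y χ η hη hχ x hx
    obtain ⟨f, rfl⟩ := oneCocycleClass_surjective
      (DiscreteGaloisModule.toTopRep (GaloisRep.restrictField E (X.torsionGaloisModule ((2 : ℕ) : ℤ)))) x
    rw [mem_kummerLocalConditionAt_iff, map_torsionPointsMapIntertwining_oneCocycleClass] at hx
    obtain ⟨Q, hQ⟩ := (oneCocycleClass_eq_zero_iff _ _).mp hx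
    have hQ' : ∀ σ : absoluteGaloisGroup E,
        pointsMap X E ((f.1 σ : geomTorsion X ((2 : ℕ) : ℤ)) : geomPoints X) = σ • Q - Q := hQ
    rw [galoisCohomology.map_one_oneCocycleClass, mem_kummerLocalConditionAt_iff,
      map_torsionPointsMapIntertwining_oneCocycleClass]
    refine (oneCocycleClass_eq_zero_iff _ _).mpr ⟨η Q, fun σ ↦ ?_⟩
    change pointsMap Y E ((χ (f.1 σ) : geomTorsion Y ((2 : ℕ) : ℤ)) : geomPoints Y) = σ • η Q - η Q
    rw [hχ, hQ', map_sub, hη]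
  -- (i) split places: every σ fixes ι(√d), θ_E is Γ_E-equivariant (§76 verbatim)
  have hsplit : ∀ (E : Type) [Field E] [Algebra K E], (∃ s : E, s ^ 2 = algebraMap K E d) →
      (Wd.kummerLocalConditionAt ((2 : ℕ) : ℤ) E).map (galoisCohomology.map (φ.restrictField E) 1) =
        W.kummerLocalConditionAt ((2 : ℕ) : ℤ) E := by
    intro E _ _ hsq
    obtain ⟨s, hs⟩ := hsq
    obtain ⟨θ, hfix, -, -, hsquare⟩ := hloc E
    have hθ : ∀ (σ : absoluteGaloisGroup E) (Q : localPoints Wd E), θ (σ • Q) = σ • θ Q :=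
      fun σ Q ↦ hfix σ (smul_closureEmb_geomSqrt_eq E hs σ) Q
    have hθ' : ∀ (σ : absoluteGaloisGroup E) (Q : localPoints W E), θ.symm (σ • Q) = σ • θ.symm Q :=
      symm_equivariant θ hθ
    have hsquare' : ∀ t : geomTorsion W ((2 : ℕ) : ℤ),
        pointsMap Wd E (ψ.symm t : geomPoints Wd) = θ.symm (pointsMap W E (t : geomPoints W)) := fun t ↦ by
      apply θ.injective
      rw [← hsquare (ψ.symm t), ψ.apply_symm_apply, θ.apply_symm_apply]
    apply le_antisymm
    · rw [AddSubgroup.map_le_iff_le_comap]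
      intro x hx
      exact key E φ θ hθ (fun t ↦ by rw [hφ]; exact hsquare t) x hx
    · intro y hy
      refine ⟨galoisCohomology.map (φ'.restrictField E) 1 y,
        key E φ' θ.symm hθ' (fun t ↦ by rw [hφ']; exact hsquare' t) y hy, ?_⟩
      obtain ⟨f, rfl⟩ := oneCocycleClass_surjective
        (DiscreteGaloisModule.toTopRep (GaloisRep.restrictField E (W.torsionGaloisModule ((2 : ℕ) : ℤ)))) y
      rw [galoisCohomology.map_one_oneCocycleClass, galoisCohomology.map_one_oneCocycleClass]
      congr 1
      apply Subtype.ext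
      ext g : 1
      rw [contOneCocycles.pullback_apply, contOneCocycles.pullback_apply]
      exact ψ.apply_symm_apply (f.1 g)
  refine ⟨φ, φ', hφ'φ, hφφ', hsplit, fun v hv hα ↦ ?_, fun v hv h2v hram ↦ ?_, fun w hw hΔ hdsq ↦ ?_,
    π, A, fun j ↦ hπ j, hA⟩
  · -- (ii) the unramified semistable row (Lemma 2.10 (iii), (v); the split sub-case by (i))
    by_cases hsq : ∃ s : v.adicCompletion K, s ^ 2 = algebraMap K (v.adicCompletion K) d
    · exact hsplit (v.adicCompletion K) hsq
    · obtain ⟨θ, hfix, hneg, hdich, hsquare⟩ := hloc (v.adicCompletion K)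
      exact map_kummerLocalConditionAt_adicCompletion_eq_of_semistable_of_mem_maxUnramified W v φ φ' hφ'φ hφφ' θ
        hfix hneg hdich (fun t ↦ by rw [hφ]; exact hsquare t) hv hα (fun s hs ↦ hsq ⟨s, hs⟩)
  · -- (iii) LEMMA 2.11 at a ramified good odd place (gk2-p5 file 9 / §76, verbatim)
    haveI : CharZero (v.adicCompletion K) :=
      Literature.NumberTheory.GaloisRepresentations.charZero_adicCompletion v
    have hn : ((2 : ℕ) : ℤ) ≠ 0 := by norm_num
    obtain ⟨θ, -, hneg, -, hsquare⟩ := hloc (v.adicCompletion K)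
    have hx2 : (closureEmb (K := K) (v.adicCompletion K) (geomSqrt d)) ^ 2 =
        algebraMap K (AlgebraicClosure (v.adicCompletion K)) d := by
      rw [← map_pow, geomSqrt_sq, AlgHom.commutes]
    obtain ⟨τ₀, hτ₀I, hτ₀⟩ := exists_mem_absInertia_smul_eq_neg v hx2 hram
    rw [eq_bot_iff]
    rintro c hc
    obtain ⟨⟨c', hc', rfl⟩, hcW⟩ := AddSubgroup.mem_inf.mp hc
    obtain ⟨T, hT2, rfl⟩ := exists_twoTorsion_localKummerMap_eq W Wd v hd hWd hv h2v hram hc'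
    have hur := KummerPT.kummerSelmerStructure_inr_eq_unramifiedSubgroup W 2 1 h2v hv
    rw [pow_one, kummerSelmerStructure_apply] at hur
    change W.kummerLocalConditionAt ((2 : ℕ) : ℤ) (v.adicCompletion K) = _ at hur
    rw [hur] at hcW
    set Q := Wd.localZSMulRoot (v.adicCompletion K) hn T with hQdef
    have hQ2 := Wd.zsmul_localZSMulRoot (v.adicCompletion K) hn T
    have hQfix := Wd.zsmul_mem_fixedPoints_of_eq (v.adicCompletion K) hQ2
    have hκ : Wd.localKummerMap (v.adicCompletion K) hn T =
        Wd.localKummerClass ((2 : ℕ) : ℤ) hn Q hQfix := rfl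
    rw [hκ, localKummerClass, galoisCohomology.map_one_oneCocycleClass] at hcW
    have hI : ∀ τ ∈ absInertia (v.adicCompletion K), ∀ w : geomTorsion W ((2 : ℕ) : ℤ),
        GaloisRep.restrictField (v.adicCompletion K) (W.torsionGaloisModule ((2 : ℕ) : ℤ)) τ w = w :=
      fun τ hτ w ↦ AcSelmer.restrictField_torsionGaloisModule_apply_of_mem_absInertia W 2 1 h2v hv hτ w
    have hzero := (LocBridge.mem_unramifiedSubgroup_one_iff_forall_eq_zero _ hI _).mp hcW τ₀ hτ₀I
    have hcoc : (Wd.localKummerCocycle ((2 : ℕ) : ℤ) hn Q hQfix).1 τ₀ = 0 := by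
      apply ψ.injective
      rw [map_zero]
      exact hzero
    have hτQ : τ₀ • Q = Q := by
      have h := Wd.pointsMap_localKummerCocycle_apply ((2 : ℕ) : ℤ) hn Q hQfix τ₀
      rw [hcoc, ZeroMemClass.coe_zero, map_zero] at h
      exact (sub_eq_zero.mp h.symm).symm ▸ rfl
    have hR4 : ((2 ^ 2 : ℕ) : ℤ) • θ Q = 0 := by
      rw [← map_zsmul, show ((2 ^ 2 : ℕ) : ℤ) = (2 : ℤ) * ((2 : ℕ) : ℤ) by norm_num, mul_zsmul, hQ2,
        ← map_zsmul, ← map_zsmul, show ((2 : ℤ)) • T = (2 : ℕ) • T by rw [← natCast_zsmul]; norm_num, hT2,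
        map_zero, map_zero, map_zero]
    have hRfix : τ₀ • θ Q = θ Q := smul_eq_self_of_mem_absInertia_of_zsmul_eq_zero W v hv h2v 2 hτ₀I hR4
    have hRneg : θ Q = -(τ₀ • θ Q) := by rw [← hneg τ₀ hτ₀ Q, hτQ]
    rw [hRfix] at hRneg
    have h2R : (2 : ℤ) • θ Q = 0 := by
      rw [two_zsmul]; nth_rewrite 1 [hRneg]; exact neg_add_cancel _
    have h2Q : ((2 : ℕ) : ℤ) • Q = 0 := by
      apply θ.injective
      rw [map_zsmul, map_zero]
      exact_mod_cast h2R
    have hT0 : T = 0 := by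
      rw [hQ2, AddEquiv.map_eq_zero_iff, map_eq_zero_iff _ (toGeomPoints_injective _)] at h2Q
      exact h2Q
    rw [hT0, map_zero, map_zero]
    exact AddSubgroup.zero_mem _
  · -- (iv) a real place with `w(Δ_W) > 0`, `d ∉ K_w²`: the untwisting anti-commutes with `σ₀` (file 23)
    obtain ⟨θ, -, hneg, -, hsquare⟩ := hloc w.Completion
    exact map_kummerLocalConditionAt_inf_eq_bot_of_neg_of_isReal W Wd hw hΔ hdsq φ θ hneg
      (fun t ↦ by rw [hφ]; exact hsquare t)

end Summit.BirchSwinnertonDyer.BirchSwinnertonDyer.Theorems.GenusKolyTwistLocal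

end
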